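import Summits.NavierStokesRegularity.TurbBounds.RBDensity
import Summits.NavierStokesRegularity.TurbBounds.ShearCoupling
import Mathlib.Topology.Algebra.Polynomial
import HarnessLib

/-!
# Plane Couette flow, streamwise-invariant ('2.5-D') spectral constraint at FUNCTION level: the per-wavenumber two-field form, the bound functional,
# the NAMED REDUCTION HYPOTHESIS, cutoff + cover (rbsdp SPEC §3 under the CERT-SHEAR §3 symbol map; RZG25)
(cell `pub-turb` / `turb-bounds`, shear lane; v2 staging, written by pub-turb-shear gen 7, 2026-08-22. Files of record: `CERT-SHEAR.md` §3–§4, §7 (label of record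
'2.5-D spectral constraint', lead decision 51 (b)); Rajkotia-Zaheer–Goluskin, JFM 2025 = arXiv:2503.04005 (held `paper:arxiv-2503.04005`), §2.1–2.2 eqs. (Q), (UB),
(UB opt spectral), App. A (their §7.1) eqs. (UB opt cons), (k>0 constraints). REUSES cert's two-field machinery verbatim: `TailPolyGenW.rbForm`, `TailTwoSided.TwoSidedX`,
`TailTwoSided.rbForm_nonneg_of_cutoff`, `RBDensity.rbForm_nonneg_of_poly2` — the Couette mode form IS `rbForm (a−1) (a−1) g k²`.)

HONEST FRAMING: rigorous bounds for the stated PDE and boundary conditions; no claim about physical turbulence beyond the bound.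
This file contains NO Navier–Stokes theory. Plane Couette flow in RZG25's units (walls `z = ∓½`, laminar profile `U(z) = z`, so `U′ = 1`; Reynolds number `Re`);
layer variable `x = 2z ∈ [−1, 1]`; background pair `(a, ζ)` with balance parameter `a > 1` and `ζ(±½) = 0`; the profile enters only through
`g(x) = (Re/2)(aU′ + ζ′)(z)` (CERT-SHEAR §3), so `ζ′ = 2g/Re − a` (`zetaPrime`) and `ζ(±½) = 0 ⇔ ∫_{−1}^{1} g = Re·a`.
* `CouettePositivity c g` — for EVERY integer spanwise wavenumber `k ≥ 1` (period `Γ_y = 2π`) the streamwise-invariant spectral-constraint form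
  `∫_{−1}^{1} c[(16/k²)W″² + 8W′² + k²W²] + c[4Θ′² + k²Θ²] + 2gWΘ dx` (`W = ŵ₃`, `Θ = ŵ₁`; RZG25 (k>0 constraints) after `x = 2z`, `×2`; `c = a − 1`) is `≥ 0` on the
  two-sided no-slip class `TwoSidedX` (`W(±1) = W′(±1) = 0`, `Θ(±1) = 0`) — literally `rbForm c c g k²` of `TailPolyGenW`;
* `couetteBound a Re g = (1/(a−1))·⟨aU′² + U′ζ′ + ζ′²/4⟩` with `⟨f⟩ = ½∫_{−1}^{1} f dx` (RZG25 (UB opt spectral), `U′ = 1`);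
* `Couette25Reduction Re D` — the NAMED HYPOTHESIS (harness model): for every `a > 1` and polynomial `g` with `∫g = Re·a`, `CouettePositivity (a−1) g → D ≤ couetteBound a Re g`,
  where `D = ⟨|∇u|²⟩‾` is the long-time mean dissipation of a STREAMWISE-INVARIANT ('2.5-D') solution — see the docstring for the exact transcription, the sources,
  and why the statement is the 2.5-D one (label of record); `C_ε = D/Re` (CERT-SHEAR §3);
and PROVES the cutoff/cover (`couettePositivity_of_cover`: `|g| ≤ T`, `T ≤ c·(m_cert+1)²` = `Certs/C…/Scalars.cutoff` ⇒ only `k ≤ m_cert` need certificates, via cert's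
`rbForm_nonneg_of_cutoff`), the value of the bound functional when `∫g = Re·a` (`couetteBound_eq_of_wall`), and the vacuity guard `couette25Reduction_laminar`
(`couetteBound ≥ a/(a−1) > 1 = ⟨U′²⟩`, the laminar dissipation, with no use of the antecedent).
NOT HERE: the two-field Legendre–Galerkin bridge to `Certs/C200/ModeForm<m>` (v2 item; `CouetteModeAssembly` + cert's `CouplingSplit`), oblique wavevectors / '3-D'.
-/

set_option linter.style.longLine false

noncomputable section

namespace Summit.NavierStokesRegularity.TurbBounds.CouetteForm

open MeasureTheory intervalIntegral Set Polynomial Finset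
open Summit.NavierStokesRegularity.TurbBounds.TailPolyGenW (rbForm)
open Summit.NavierStokesRegularity.TurbBounds.TailTwoSided (TwoSidedX rbForm_nonneg_of_cutoff)
open Summit.NavierStokesRegularity.TurbBounds.LadderTail (w)
open Summit.NavierStokesRegularity.TurbBounds.LegendreCoeffs
open Summit.NavierStokesRegularity.TurbBounds.ShearCoupling (tailFrom integral_tailFrom_sq legCoeff_tailFrom)

/-! ## 1. Objects -/

/-- `ζ′` on the layer variable: `ζ′(z) = 2g(x)/Re − a` at `x = 2z` (from `g = (Re/2)(aU′ + ζ′)`, `U′ = 1`). -/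
def zetaPrime (a Re : ℝ) (g : ℝ → ℝ) (x : ℝ) : ℝ := 2 * g x / Re - a

/-- The bound functional of RZG25 (UB opt spectral): `(1/(a−1))·⟨aU′² + U′ζ′ + ζ′²/4⟩`, `⟨f⟩ = ½∫_{−1}^{1} f dx`, `U′ = 1`. -/
def couetteBound (a Re : ℝ) (g : ℝ → ℝ) : ℝ :=
  1 / (a - 1) * (1 / 2 * ∫ x in (-1 : ℝ)..1, (a + zetaPrime a Re g x + (zetaPrime a Re g x) ^ 2 / 4))

/-- The streamwise-invariant spectral constraint of the background pair, wavenumber by wavenumber: for every INTEGER `k ≥ 1` (period `Γ_y = 2π`) the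
two-field form `rbForm c c g k²` is `≥ 0` on the two-sided no-slip class (`c = a − 1`). -/
def CouettePositivity (c : ℝ) (g : ℝ → ℝ) : Prop :=
  ∀ k : ℕ, 1 ≤ k → ∀ W Θ : ℝ → ℝ, TwoSidedX W Θ → 0 ≤ rbForm c c g ((k : ℝ) ^ 2) W Θ

/-! ## 2. The named reduction hypothesis (CITED; used as a hypothesis, never proved in this cell) -/

/-- **Named hypothesis `Couette25Reduction Re D`** (harness model, like `LayerForm.LayerReduction` / `ShearForm.FW16Reduction`). TRANSCRIPTION for the referee:
plane Couette flow between no-slip walls `z = ∓½` moving with relative speed 1, Reynolds number `Re > 0`, laminar profile `U = z` [RZG25 §2]; for every balance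
parameter `a > 1` and every background field `ζ(z)x̂` in the no-slip class (`ζ(±½) = 0`) — encoded by the polynomial `g = (Re/2)(aU′ + ζ′)` on `x = 2z` with
`∫_{−1}^{1} g = Re·a` (⇔ `∫ζ′ = 0`) — RZG25 (UB): `⟨|∇u|²⟩‾ ≤ max_{w ∈ 𝓗} 𝒬[w]`, (eq. after (F),(E)): `max 𝒬 = (1/(a−1))⟨aU′² + U′ζ′ + ζ′²/4⟩` iff the spectral constraint
`𝓔[w] ≤ 0` holds for all mean-free `w ∈ 𝓗` [RZG25 §2.1–2.2, (Q), (UB), (UB opt spectral)]; for the class `𝓗 = 𝓗_{2.5D}` of streamwise-invariant fields of spanwise period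
`2π` the constraint decomposes over the integer spanwise wavenumbers `k ≥ 1` into exactly the forms of `CouettePositivity (a−1) g` with real `ŵ₁, ŵ₃` and no-slip data
`ŵ₁ = ŵ₃ = ŵ₃′ = 0` at the walls [RZG25 App. A (their §7.1), (UB opt cons), (k>0 constraints); CERT-SHEAR §3 for the map `x = 2z`, `(W, Θ) = (ŵ₃, ŵ₁)`], the `k = 0`
part being the mean-flow maximisation that produces the bound functional [RZG25 §2.2]; RZG25's function spaces `𝓗_{w₁}`, `𝓗_{w₃}` also encode a
`z`-symmetry of the optimal fields (App. A step (i)) which `CouettePositivity` drops — a LARGER test class, the safe direction (referee gen 45 remark I-1). [cite: RajkotiazaheerGoluskin2025, §2.1–2.2, App. A] MEANING OF `D` AND SCOPE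
(label of record '2.5-D spectral constraint', lead decision 51 (b)): `D` is the long-time mean dissipation `⟨|∇u|²⟩‾` of SOME streamwise-invariant (x-independent)
solution of the Navier–Stokes system in this geometry (RZG25's `𝓗_{2.5D}` dynamics), for which the identity `⟨|∇u|²⟩‾ = 𝒬[v]‾` and the bound hold with
`𝓗 = 𝓗_{2.5D}`; the dissipation coefficient of record is `C_ε = D/Re` (CERT-SHEAR §3). NOTHING is asserted about genuinely three-dimensional solutions
(that needs the oblique wavevectors or Busse's criterion, RZG25 §3 — not certified). As for `FW16Reduction`, the `C²/C¹` two-sided class used here is dense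
in the `H² × H¹` class of the source and the forms are continuous there (refereed density remark of `LayerReduction`). VACUITY: satisfiable as typed
(`couette25Reduction_laminar`: `D = 1`, the laminar dissipation `⟨U′²⟩`, obeys it with no use of the antecedent); non-trivial per row from the certificate. -/
def Couette25Reduction (Re D : ℝ) : Prop :=
  ∀ (a : ℝ) (gq : ℝ[X]), 1 < a → (∫ x in (-1 : ℝ)..1, gq.eval x) = Re * a →
    CouettePositivity (a - 1) (fun x => gq.eval x) → D ≤ couetteBound a Re (fun x => gq.eval x)

/-! ## 3. Cutoff and cover (CERT-SHEAR §3 lemma R-SC = rbsdp SPEC 3.8 D1 with `A₀s = c²`) -/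

/-- **Cover.** If `c > 0`, `|g| ≤ T` on `[−1, 1]`, the certificates' cutoff line `T ≤ c·(m_cert + 1)²` holds (`Certs/C…/Scalars.cutoff`) and the form is `≥ 0` on the
two-sided class for the finitely many wavenumbers `1 ≤ k ≤ m_cert`, then `CouettePositivity c g` (every `k ≥ m_cert + 1` is free by cert's `rbForm_nonneg_of_cutoff`:
`T² ≤ c·c·K_c²` with `K_c = (m_cert+1)² ≤ k²`). -/
theorem couettePositivity_of_cover {c T : ℝ} {g : ℝ → ℝ} {mCert : ℕ} (hc : 0 < c) (hg : ∀ x ∈ Icc (-1 : ℝ) 1, |g x| ≤ T)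
    (hcut : T ≤ c * ((mCert : ℝ) + 1) ^ 2)
    (hfin : ∀ k : ℕ, 1 ≤ k → k ≤ mCert → ∀ W Θ : ℝ → ℝ, TwoSidedX W Θ → 0 ≤ rbForm c c g ((k : ℝ) ^ 2) W Θ) :
    CouettePositivity c g := by
  intro k hk W Θ hWΘ
  by_cases hle : k ≤ mCert
  · exact hfin k hk hle W Θ hWΘ
  · have hT0 : 0 ≤ T := le_trans (abs_nonneg _) (hg (-1) ⟨le_rfl, by norm_num⟩)
    have hKc : (0 : ℝ) < ((mCert : ℝ) + 1) ^ 2 := by positivity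
    have hcut2 : T ^ 2 ≤ c * c * (((mCert : ℝ) + 1) ^ 2) ^ 2 := by
      have h1 : T ^ 2 ≤ (c * ((mCert : ℝ) + 1) ^ 2) ^ 2 := pow_le_pow_left₀ hT0 hcut 2
      calc T ^ 2 ≤ (c * ((mCert : ℝ) + 1) ^ 2) ^ 2 := h1
        _ = c * c * (((mCert : ℝ) + 1) ^ 2) ^ 2 := by ring
    have hK : ((mCert : ℝ) + 1) ^ 2 ≤ ((k : ℝ)) ^ 2 := by
      have hk' : (mCert : ℝ) + 1 ≤ (k : ℝ) := by exact_mod_cast (show mCert + 1 ≤ k by omega)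
      exact pow_le_pow_left₀ (by positivity) hk' 2
    exact rbForm_nonneg_of_cutoff hc.le hc.le hKc hg hcut2 hK W Θ

/-! ## 4. The bound functional under the wall condition, and the vacuity guard -/

/-- With the wall condition `∫_{−1}^{1} g = Re·a` (`Re ≠ 0`) the linear term drops: `couetteBound a Re g = (a + (1/8)∫(2g/Re − a)²)/(a − 1)` (continuous `g`). -/
theorem couetteBound_eq_of_wall {a Re : ℝ} {g : ℝ → ℝ} (hRe : Re ≠ 0) (hg : Continuous g) (hwall : (∫ x in (-1 : ℝ)..1, g x) = Re * a) :
    couetteBound a Re g = (a + 1 / 8 * ∫ x in (-1 : ℝ)..1, (2 * g x / Re - a) ^ 2) / (a - 1) := by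
  unfold couetteBound zetaPrime
  have hz : Continuous fun x => 2 * g x / Re - a := by fun_prop
  have i1 : IntervalIntegrable (fun _ => a) volume (-1 : ℝ) 1 := intervalIntegrable_const
  have i2 : IntervalIntegrable (fun x => 2 * g x / Re - a) volume (-1 : ℝ) 1 := hz.intervalIntegrable _ _
  have i3 : IntervalIntegrable (fun x => (2 * g x / Re - a) ^ 2 / 4) volume (-1 : ℝ) 1 := Continuous.intervalIntegrable (by fun_prop) _ _
  rw [intervalIntegral.integral_add (i1.add i2) i3, intervalIntegral.integral_add i1 i2]
  have ea : (∫ x in (-1 : ℝ)..1, (a : ℝ)) = 2 * a := by rw [intervalIntegral.integral_const, smul_eq_mul]; ring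
  have ez : (∫ x in (-1 : ℝ)..1, (2 * g x / Re - a)) = 0 := by
    rw [intervalIntegral.integral_sub (Continuous.intervalIntegrable (by fun_prop) _ _) i1]
    have : (∫ x in (-1 : ℝ)..1, 2 * g x / Re) = 2 / Re * ∫ x in (-1 : ℝ)..1, g x := by
      rw [← intervalIntegral.integral_const_mul]
      exact intervalIntegral.integral_congr fun x _ => by ring
    rw [this, hwall, intervalIntegral.integral_const, smul_eq_mul]
    field_simp
    ring
  have eq : (∫ x in (-1 : ℝ)..1, (2 * g x / Re - a) ^ 2 / 4) = 1 / 4 * ∫ x in (-1 : ℝ)..1, (2 * g x / Re - a) ^ 2 := by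
    rw [← intervalIntegral.integral_const_mul]
    exact intervalIntegral.integral_congr fun x _ => by ring
  rw [ea, ez, eq]
  field_simp
  ring

/-- The bound functional is at least `a/(a−1) ≥ 1` under the wall condition (`a > 1`, `Re ≠ 0`). -/
theorem one_le_couetteBound {a Re : ℝ} {g : ℝ → ℝ} (ha : 1 < a) (hRe : Re ≠ 0) (hg : Continuous g)
    (hwall : (∫ x in (-1 : ℝ)..1, g x) = Re * a) : 1 ≤ couetteBound a Re g := by
  rw [couetteBound_eq_of_wall hRe hg hwall]
  have hI : 0 ≤ ∫ x in (-1 : ℝ)..1, (2 * g x / Re - a) ^ 2 := intervalIntegral.integral_nonneg (by norm_num) fun x _ => by positivity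
  rw [le_div_iff₀ (by linarith)]
  linarith

/-- **Vacuity guard: `Couette25Reduction` is satisfiable as typed.** The laminar dissipation `D = ⟨U′²⟩ = 1` obeys it for every `Re > 0` (the bound functional is
`≥ 1` for every admissible pair) — with NO use of the antecedent. -/
theorem couette25Reduction_laminar {Re : ℝ} (hRe : 0 < Re) : Couette25Reduction Re 1 := by
  intro a gq ha hwall _
  exact one_le_couetteBound ha hRe.ne' gq.continuous hwall

/-! ## 5. The bound functional of a Legendre profile `g = Σ_{p ≤ P} ĝ_p P_p` with `ĝ₀ = Re·a/2` -/

/-- For a Legendre profile `g = Σ_{p ≤ P} ĝ_p P_p` (`ghat` its data, any `P`): `∫_{−1}^{1} g = 2ĝ₀`. -/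
theorem integral_legendreProfile (P : ℕ) (ghat : ℕ → ℝ) :
    (∫ x in (-1 : ℝ)..1, (∑ p ∈ range (P + 1), C (ghat p) * Literature.Analysis.SpecialFunctions.legendre p).eval x) = 2 * ghat 0 := by
  set gp : ℝ[X] := ∑ p ∈ range (P + 1), C (ghat p) * Literature.Analysis.SpecialFunctions.legendre p with hgp
  have h := legCoeff_expansion P ghat 0
  rw [if_pos (Nat.zero_le _)] at h
  unfold legCoeff at h
  have e : (∫ x in (-1 : ℝ)..1, gp.eval x * (Literature.Analysis.SpecialFunctions.legendre 0).eval x) = ∫ x in (-1 : ℝ)..1, gp.eval x :=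
    intervalIntegral.integral_congr fun x _ => by simp [Literature.Analysis.SpecialFunctions.legendre_zero]
  rw [hgp] at e
  rw [e] at h
  norm_num at h
  linarith

/-- For a Legendre profile `g = Σ_{p ≤ P} ĝ_p P_p`: `∫_{−1}^{1} (g − ĝ₀)² = Σ_{1 ≤ p ≤ P} (2/(2p+1)) ĝ_p²` (Parseval for the tail from index 1). -/
theorem integral_sq_sub_mean_legendreProfile (P : ℕ) (ghat : ℕ → ℝ) :
    (∫ x in (-1 : ℝ)..1, ((∑ p ∈ range (P + 1), C (ghat p) * Literature.Analysis.SpecialFunctions.legendre p).eval x - ghat 0) ^ 2)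
      = ∑ k ∈ range P, w (1 + k) * ghat (1 + k) ^ 2 := by
  set gp : ℝ[X] := ∑ p ∈ range (P + 1), C (ghat p) * Literature.Analysis.SpecialFunctions.legendre p with hgp
  have hdeg : gp.natDegree < 1 + P := by
    have : gp.natDegree ≤ P := by
      rw [hgp]
      refine natDegree_sum_le_of_forall_le _ _ fun p hp => ?_
      have hp' : p ≤ P := by have := mem_range.mp hp; omega
      exact (natDegree_C_mul_le _ _).trans ((Literature.Analysis.SpecialFunctions.natDegree_legendre p).le.trans hp')
    omega
  have ht := integral_tailFrom_sq 1 gp (L := P) hdeg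
  have hc0 : legCoeff gp 0 = ghat 0 := by rw [hgp, legCoeff_expansion, if_pos (Nat.zero_le _)]
  have htail : ∀ x, (tailFrom 1 gp).eval x = gp.eval x - ghat 0 := by
    intro x
    unfold tailFrom
    simp [hc0, Literature.Analysis.SpecialFunctions.legendre_zero]
  have hcoef : ∀ k, legCoeff gp (1 + k) = if 1 + k ≤ P then ghat (1 + k) else 0 := fun k => by rw [hgp, legCoeff_expansion]
  rw [show (∫ x in (-1 : ℝ)..1, (gp.eval x - ghat 0) ^ 2) = ∫ x in (-1 : ℝ)..1, (tailFrom 1 gp).eval x ^ 2 from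
    intervalIntegral.integral_congr fun x _ => by rw [htail]]
  rw [ht]
  refine sum_congr rfl fun k hk => ?_
  rw [hcoef, if_pos (by have := mem_range.mp hk; omega)]

end Summit.NavierStokesRegularity.TurbBounds.CouetteForm

end
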